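import Mathlib.Topology.Algebra.OpenSubgroup
import Mathlib.GroupTheory.QuotientGroup.Basic
import Literature.NumberTheory.GaloisRepresentations.NearlyOrdinaryDeformationRing
import Literature.NumberTheory.GaloisRepresentations.DeformationCoefficientAlgebras
import HarnessLib

/-!
# Lifting conditions and the universal ring at a finite level (Mazur §20 Prop. 2, §23)

Topic `Literature/NumberTheory/GaloisRepresentations`.  Step 3 of the construction behind the
named fact `nearlyOrdinaryDeformationRing_nonempty` (`NearlyOrdinaryDeformationRing.lean`;
Calegari–Mazur §2.2 → Mazur §30 → Mazur §20 Prop. 2 and §23).  We work with RIGID lifts (no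
quotient by strict equivalence; the rigidification of the nearly ordinary problem is done in a
later file) of a residual representation `r̄ : Γ → GL_n(k)` to objects of Mazur's category
`Ĉ_𝒪(k)` (`Deformation.CNLAlgebra`, file `DeformationCoefficientAlgebras.lean`).

* `Deformation.LiftingCondition 𝒪 k Γ n r̄` — an abstract lifting condition `𝒞`: for each
  `A ∈ Ĉ_𝒪(k)` a set `𝒞(A)` of `𝔪_A`-adically continuous lifts of `r̄`, functorial, containing
  `r̄`, and DETECTED BY JOINTLY INJECTIVE FAMILIES of morphisms — the last axiom is Mazur's
  conditions (1)–(3) of §23 on a "deformation condition" (morphisms, fibre products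
  `A ×_C B ⊆ A × B`, injections) together with continuity in `A = lim A/𝔪^m`.
* `Deformation.glOfJointlyInjective` — a matrix-valued function whose images under a jointly
  injective family are homomorphisms is a homomorphism (used throughout to build lifts).
* THE FINITE LEVEL.  For an open normal subgroup `U ≤ ker r̄` of finite index:
  `levelAmbient` = `Λ_U = 𝒪[X_{g,i,j} : g ∈ Γ/U]^` completed at the point `r̄`
  (`PowerSeriesAt`), the good ideals `IsGood` (those `𝔞` modulo which the tautological matrices
  `(X_{[γ],i,j})` are an admissible lift trivial on `U`), `levelIdeal = ⋂ good`,
  **`levelRing 𝒞 U = R_U = Λ_U/I_U`** with its tautological lift `levelRep = ρ_U ∈ 𝒞(R_U)`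
  (`levelRep_mem`; `I_U` is good because admissibility is detected by the jointly injective
  family `R_U → Λ_U/𝔞`), and the **universal property** (`levelLift`, `map_comp_levelRep`,
  `levelLift_unique`, `existsUnique_levelLift`): admissible lifts `ρ ∈ 𝒞(A)` trivial on `U`
  correspond bijectively to morphisms `R_U → A`, `φ ↦ φ ∘ ρ_U` — Mazur's Prop. 2 of §20 for the
  finite group `Γ/U` (where no `p`-finiteness is needed), proved here directly rather than via
  Schlessinger's criterion: existence of `R_U → A` from the universal property of `Λ_U`
  (the kernels `ker(Λ_U → A/𝔪_A^{m+1})` are good), uniqueness because `R_U` is topologically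
  generated by the entries of `ρ_U`.

Everything is proved; no named facts.  The passage to the profinite group (limit over `U`,
Noetherianity from the finiteness of `𝒞(k[ε])`) is the next file.

## References

* [Maz] B. Mazur, *An introduction to the deformation theory of Galois representations*, in
  Modular Forms and Fermat's Last Theorem (Springer 1997), §20 Prop. 2 (representability for
  absolutely irreducible / `End = k` residual representations), §23 ("Deformation conditions",
  conditions (1)–(3)). [cite: Mazur1997Deformation, §20 Prop. 2 and §23]
* [CM] F. Calegari, B. Mazur, J. Inst. Math. Jussieu 8 (2009), §2.2. [cite: CalegariMazur2008, §2.2]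
-/

noncomputable section

open IsLocalRing Matrix

namespace Literature.NumberTheory.GaloisRepresentations.Deformation

universe u


/-! ### Group homomorphisms into `GL_n` detected through a jointly injective family -/

section Detect

variable {Γ : Type*} [Group Γ] {n : Type*} [Fintype n] [DecidableEq n] {A : Type*} [CommRing A]

/-- **Homomorphy is detected by a jointly injective family.**  A matrix-valued function
`T : Γ → M_n(A)` whose images under a jointly injective family of ring homomorphisms
`f i : A → B i` are the underlying matrices of group homomorphisms `ρ i : Γ → GL_n(B i)` is itself
(the underlying function of) a group homomorphism `Γ → GL_n(A)`. [folklore] -/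
def glOfJointlyInjective (T : Γ → Matrix n n A) {ι : Type*} {B : ι → Type*}
    [∀ i, CommRing (B i)] (f : ∀ i, A →+* B i) (hf : ∀ a : A, (∀ i, f i a = 0) → a = 0)
    (ρ : ∀ i, Γ →* GL n (B i)) (hρ : ∀ i γ, (ρ i γ).val = (T γ).map (f i)) : Γ →* GL n A :=
  MonoidHom.toHomUnits
    { toFun := T
      map_one' := by
        ext a b
        refine sub_eq_zero.1 (hf _ fun i => ?_)
        have h := congrFun (congrFun (hρ i 1) a) b
        rw [map_one, Units.val_one] at h
        rw [map_sub, Matrix.one_apply, ← Matrix.map_apply (f := f i), ← h, Matrix.one_apply]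
        split_ifs <;> simp
      map_mul' := fun γ δ => by
        ext a b
        refine sub_eq_zero.1 (hf _ fun i => ?_)
        have h := hρ i (γ * δ)
        rw [map_mul, Units.val_mul, hρ i γ, hρ i δ, ← Matrix.map_mul] at h
        have h' := congrFun (congrFun h a) b
        rw [Matrix.map_apply, Matrix.map_apply] at h'
        rw [map_sub, h', sub_self] }

/-- The underlying matrices of `glOfJointlyInjective` are the given ones. [folklore] -/
@[simp] theorem glOfJointlyInjective_val (T : Γ → Matrix n n A) {ι : Type*} {B : ι → Type*}
    [∀ i, CommRing (B i)] (f : ∀ i, A →+* B i) (hf : ∀ a : A, (∀ i, f i a = 0) → a = 0)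
    (ρ : ∀ i, Γ →* GL n (B i)) (hρ : ∀ i γ, (ρ i γ).val = (T γ).map (f i)) (γ : Γ) :
    (glOfJointlyInjective T f hf ρ hρ γ).val = T γ := rfl

/-- `glOfJointlyInjective` maps to the given homomorphisms. [folklore] -/
theorem map_comp_glOfJointlyInjective (T : Γ → Matrix n n A) {ι : Type*} {B : ι → Type*}
    [∀ i, CommRing (B i)] (f : ∀ i, A →+* B i) (hf : ∀ a : A, (∀ i, f i a = 0) → a = 0)
    (ρ : ∀ i, Γ →* GL n (B i)) (hρ : ∀ i γ, (ρ i γ).val = (T γ).map (f i)) (i : ι) :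
    (Matrix.GeneralLinearGroup.map (f i)).comp (glOfJointlyInjective T f hf ρ hρ) = ρ i := by
  refine MonoidHom.ext fun γ => Units.ext ?_
  rw [hρ i γ]
  rfl

end Detect

/-! ### Lifting conditions (Mazur's deformation conditions, rigid form) -/

variable (𝒪 : Type u) [CommRing 𝒪] (k : Type u) [Field k] [Algebra 𝒪 k]
variable (Γ : Type u) [Group Γ] [TopologicalSpace Γ] (n : ℕ)

/-- A **lifting condition** for the residual representation `r̄ : Γ → GL_n(k)` on Mazur's category
`Ĉ_𝒪(k)`: for every object `A` a set `𝒞(A)` of continuous lifts `ρ : Γ → GL_n(A)` of `r̄`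
(`GL_n(π_A) ∘ ρ = r̄`), functorial in `A`, containing `r̄` itself, and **detected by jointly
injective families**: a continuous `ρ` lies in `𝒞(A)` as soon as its images under a jointly
injective family of morphisms `A → B_i` do.  The last axiom packages Mazur's conditions on a
"deformation condition" [Maz, §23] (closure under fibre products `A ×_C B ⊆ A × B`, under passage
to subrings, and continuity in `A = lim A/𝔪^m`); the rigid (set-valued rather than groupoid)
form is the one used for the rigidified nearly ordinary problem.  No quotient by strict
equivalence is taken here. [cite: Mazur1997Deformation, §23] -/
structure LiftingCondition (rbar : Γ →* GL (Fin n) k) : Type (u + 1) where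
  /-- The admissible lifts over each object of `Ĉ_𝒪(k)`. -/
  carrier : ∀ A : CNLAlgebra 𝒪 k, Set (Γ →* GL (Fin n) A)
  /-- Functoriality. -/
  map_mem : ∀ {A B : CNLAlgebra 𝒪 k} (φ : A →ₐ[𝒪] B) {ρ : Γ →* GL (Fin n) A},
    ρ ∈ carrier A → (Matrix.GeneralLinearGroup.map (φ : A →+* B)).comp ρ ∈ carrier B
  /-- The residual representation is admissible. -/
  self_mem : rbar ∈ carrier (CNLAlgebra.self 𝒪 k)
  /-- Admissible lifts reduce to `r̄`. -/
  residual_eq : ∀ {A : CNLAlgebra 𝒪 k} {ρ : Γ →* GL (Fin n) A}, ρ ∈ carrier A →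
    (Matrix.GeneralLinearGroup.map (A.residue : A →+* k)).comp ρ = rbar
  /-- Admissible lifts are continuous for the `𝔪_A`-adic topology. -/
  isAdicContinuous : ∀ {A : CNLAlgebra 𝒪 k} {ρ : Γ →* GL (Fin n) A}, ρ ∈ carrier A →
    IsAdicContinuous ρ
  /-- Admissibility is detected by jointly injective families of morphisms. -/
  mem_of_jointly_injective : ∀ {A : CNLAlgebra 𝒪 k} {ι : Type u} (B : ι → CNLAlgebra 𝒪 k)
    (φ : ∀ i, A →ₐ[𝒪] B i), (∀ a : A, (∀ i, φ i a = 0) → a = 0) →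
    ∀ {ρ : Γ →* GL (Fin n) A}, IsAdicContinuous ρ →
      (∀ i, (Matrix.GeneralLinearGroup.map (φ i : A →+* B i)).comp ρ ∈ carrier (B i)) →
      ρ ∈ carrier A

namespace LiftingCondition

variable {𝒪 k Γ n} {rbar : Γ →* GL (Fin n) k} (𝒞 : LiftingCondition 𝒪 k Γ n rbar)

/-- The entries of an admissible lift reduce to the entries of `r̄`. [folklore] -/
theorem residue_apply_val {A : CNLAlgebra 𝒪 k} {ρ : Γ →* GL (Fin n) A} (hρ : ρ ∈ 𝒞.carrier A)
    (γ : Γ) (i j : Fin n) : A.residue ((ρ γ).val i j) = (rbar γ).val i j := by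
  have h := DFunLike.congr_fun (𝒞.residual_eq hρ) γ
  have h2 := Matrix.GeneralLinearGroup.map_apply (A.residue : A →+* k) i j (ρ γ)
  rw [MonoidHom.comp_apply] at h
  rw [h] at h2
  exact h2.symm

/-! ### The finite level: lifts factoring through a finite quotient `Γ/U` -/

section Level

variable (hk : Function.Surjective (algebraMap 𝒪 k)) [IsNoetherianRing 𝒪]
variable (U : Subgroup Γ) [U.Normal] [Finite (Γ ⧸ U)] (hU : U ≤ rbar.ker)

/-- The variables of the level-`U` ring: one for each entry of each element of `Γ/U`. [folklore] -/
abbrev LevelVars (U : Subgroup Γ) : Type u := (Γ ⧸ U) × Fin n × Fin n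

/-- The `k`-point `(r̄(g)_{ij})` of the polynomial ring in the level variables. [folklore] -/
def levelPoint : LevelVars (n := n) U → k :=
  fun v => (QuotientGroup.lift U rbar hU v.1).val v.2.1 v.2.2

omit [TopologicalSpace Γ] [Finite (Γ ⧸ U)] in
/-- `levelPoint` on representatives. [folklore] -/
@[simp] theorem levelPoint_mk (γ : Γ) (i j : Fin n) :
    levelPoint U hU (⟨(γ : Γ ⧸ U), i, j⟩ : LevelVars (n := n) U) = (rbar γ).val i j := rfl

/-- The completed polynomial algebra `Λ_U = 𝒪[X_{g,i,j}]^` at the point `r̄`, as an object of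
`Ĉ_𝒪(k)`. [cite: Mazur1997Deformation, §20 Prop. 2 (proof)] -/
def levelAmbient : CNLAlgebra 𝒪 k := PowerSeriesAt.toCNL (levelPoint U hU) hk

/-- The tautological matrices `(X_{[γ],i,j}) mod 𝔞`. [folklore] -/
def tautMatrix (𝔞 : Ideal (levelAmbient hk U hU)) (γ : Γ) :
    Matrix (Fin n) (Fin n) ((levelAmbient hk U hU) ⧸ 𝔞) :=
  Matrix.of fun i j => Ideal.Quotient.mk 𝔞 (PowerSeriesAt.X 𝒪 (levelPoint U hU) ⟨(γ : Γ ⧸ U), i, j⟩)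

omit [TopologicalSpace Γ] in
/-- The tautological matrices are constant on `U`-cosets. [folklore] -/
theorem tautMatrix_mul_mem (𝔞 : Ideal (levelAmbient hk U hU)) (γ : Γ) {u : Γ} (hu : u ∈ U) :
    tautMatrix hk U hU 𝔞 (γ * u) = tautMatrix hk U hU 𝔞 γ := by
  ext i j
  simp only [tautMatrix, Matrix.of_apply]
  rw [QuotientGroup.mk_mul, (QuotientGroup.eq_one_iff u).2 hu, mul_one]

/-- **Good ideals**: `𝔞 ⊂ Λ_U` is good if the tautological matrices modulo `𝔞` are the values of
an admissible lift over `Λ_U/𝔞` trivial on `U`. [cite: Mazur1997Deformation, §20 Prop. 2 (proof)] -/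
def IsGood (𝔞 : Ideal (levelAmbient hk U hU)) : Prop :=
  ∃ h𝔞 : 𝔞 ≠ ⊤, ∃ ρ ∈ 𝒞.carrier ((levelAmbient hk U hU).quotient 𝔞 h𝔞),
    U ≤ ρ.ker ∧ ∀ γ, (ρ γ).val = tautMatrix hk U hU 𝔞 γ

/-- The ideal of the level-`U` universal ring: the intersection of all good ideals.
[cite: Mazur1997Deformation, §20 Prop. 2 (proof)] -/
def levelIdeal : Ideal (levelAmbient hk U hU) := sInf {𝔞 | 𝒞.IsGood hk U hU 𝔞}

/-- `I_U` is contained in every good ideal. [folklore] -/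
theorem levelIdeal_le {𝔞 : Ideal (levelAmbient hk U hU)} (h : 𝒞.IsGood hk U hU 𝔞) :
    𝒞.levelIdeal hk U hU ≤ 𝔞 := sInf_le h

-- Openness hypothesis on `U`, packaged as it is used: every subgroup containing `U` is open
-- (for a topological group this says exactly that `U` is open, `Subgroup.isOpen_mono`).
variable (hUo : ∀ ⦃H : Subgroup Γ⦄, U ≤ H → IsOpen (H : Set Γ))

omit [IsNoetherianRing 𝒪] [Finite (Γ ⧸ U)] [U.Normal] in
include hUo in
/-- A homomorphism into `GL_m(A)` trivial on the open subgroup `U` is `𝔪_A`-adically continuous.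
[folklore] -/
theorem isAdicContinuous_of_le_ker {A : Type*} [CommRing A] [IsLocalRing A] {m : ℕ}
    {ρ : Γ →* GL (Fin m) A} (h : U ≤ ρ.ker) : IsAdicContinuous ρ := by
  intro l
  apply hUo
  intro u hu
  rw [MonoidHom.mem_ker, MonoidHom.comp_apply, h hu, map_one]

omit [TopologicalSpace Γ] in
/-- A lift built from tautological matrices is trivial on `U`. [folklore] -/
theorem le_ker_of_val_eq_tautMatrix {𝔞 : Ideal (levelAmbient hk U hU)}
    {ρ : Γ →* GL (Fin n) ((levelAmbient hk U hU) ⧸ 𝔞)} (h : ∀ γ, (ρ γ).val = tautMatrix hk U hU 𝔞 γ) :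
    U ≤ ρ.ker := by
  intro u hu
  rw [MonoidHom.mem_ker]
  apply Units.ext
  rw [h u, Units.val_one, ← one_mul u, tautMatrix_mul_mem hk U hU 𝔞 1 hu, ← h 1, map_one,
    Units.val_one]

/-! #### The maximal ideal of `Λ_U` is good -/

include hUo in
/-- **The maximal ideal of `Λ_U` is good** (the tautological matrices reduce to `r̄`).
[cite: Mazur1997Deformation, §23 (a deformation condition contains `(k, V̄)`)] -/
theorem isGood_maximalIdeal : 𝒞.IsGood hk U hU (maximalIdeal (levelAmbient hk U hU)) := by
  have hne : maximalIdeal (levelAmbient hk U hU) ≠ ⊤ := (maximalIdeal.isMaximal _).ne_top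
  -- `B = Λ/𝔪` and its (injective) augmentation
  have hBres : ∀ x : levelAmbient hk U hU,
      ((levelAmbient hk U hU).quotient _ hne).residue (Ideal.Quotient.mk _ x) =
        (levelAmbient hk U hU).residue x :=
    fun x => CNLAlgebra.quotient_residue_mk _ _ hne x
  have hinj : Function.Injective ((levelAmbient hk U hU).quotient _ hne).residue := by
    rw [injective_iff_map_eq_zero]
    intro b hb
    obtain ⟨x, rfl⟩ := Ideal.Quotient.mk_surjective b
    rw [hBres, ← CNLAlgebra.mem_maximalIdeal_iff] at hb
    exact Ideal.Quotient.eq_zero_iff_mem.2 hb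
  have hji : ∀ b : (levelAmbient hk U hU).quotient _ hne,
      (∀ _i : PUnit.{u + 1}, ((levelAmbient hk U hU).quotient _ hne).residue b = 0) → b = 0 :=
    fun b h => hinj (by rw [h PUnit.unit, map_zero])
  have hval : ∀ (_i : PUnit.{u + 1}) (γ : Γ), (rbar γ).val =
      (tautMatrix hk U hU (maximalIdeal (levelAmbient hk U hU)) γ).map
        (((levelAmbient hk U hU).quotient _ hne).residue :
          (levelAmbient hk U hU).quotient _ hne →+* (CNLAlgebra.self 𝒪 k)) := by
    intro _ γ
    ext i j
    rw [Matrix.map_apply]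
    change (rbar γ).val i j = ((levelAmbient hk U hU).quotient _ hne).residue
      (Ideal.Quotient.mk _ (PowerSeriesAt.X 𝒪 (levelPoint U hU) ⟨(γ : Γ ⧸ U), i, j⟩))
    rw [hBres]
    exact ((PowerSeriesAt.residue_X 𝒪 (levelPoint U hU) ⟨(γ : Γ ⧸ U), i, j⟩).trans
      (levelPoint_mk U hU γ i j)).symm
  obtain ⟨ρ₀, hρ₀, hcomp⟩ : ∃ ρ₀ : Γ →* GL (Fin n) ((levelAmbient hk U hU).quotient _ hne),
      (∀ γ, (ρ₀ γ).val = tautMatrix hk U hU (maximalIdeal (levelAmbient hk U hU)) γ) ∧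
      ∀ i : PUnit.{u + 1}, (Matrix.GeneralLinearGroup.map
        (((levelAmbient hk U hU).quotient _ hne).residue :
          (levelAmbient hk U hU).quotient _ hne →+* (CNLAlgebra.self 𝒪 k))).comp ρ₀ = rbar :=
    ⟨glOfJointlyInjective _ _ hji (fun _ => rbar) hval, fun _ => rfl,
      map_comp_glOfJointlyInjective _ _ hji (fun _ => rbar) hval⟩
  have hU₀ : U ≤ ρ₀.ker := le_ker_of_val_eq_tautMatrix hk U hU hρ₀
  refine ⟨hne, ρ₀, ?_, hU₀, hρ₀⟩
  refine 𝒞.mem_of_jointly_injective (ι := PUnit.{u + 1}) (fun _ => CNLAlgebra.self 𝒪 k)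
    (fun _ => ((levelAmbient hk U hU).quotient _ hne).residue) hji
    (isAdicContinuous_of_le_ker U hUo hU₀) fun i => ?_
  show (Matrix.GeneralLinearGroup.map (((levelAmbient hk U hU).quotient _ hne).residue :
    (levelAmbient hk U hU).quotient _ hne →+* (CNLAlgebra.self 𝒪 k))).comp ρ₀ ∈ _
  rw [hcomp i]
  exact 𝒞.self_mem

include hUo in
/-- `I_U` is a proper ideal. [folklore] -/
theorem levelIdeal_ne_top : 𝒞.levelIdeal hk U hU ≠ ⊤ := fun h =>
  (maximalIdeal.isMaximal _).ne_top
    (top_le_iff.1 (h ▸ 𝒞.levelIdeal_le hk U hU (𝒞.isGood_maximalIdeal hk U hU hUo)))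

/-! #### The level-`U` universal ring and its tautological lift -/

/-- **The level-`U` universal ring** `R_U = Λ_U / I_U`. [cite: Mazur1997Deformation, §20 Prop. 2] -/
def levelRing : CNLAlgebra 𝒪 k :=
  (levelAmbient hk U hU).quotient (𝒞.levelIdeal hk U hU) (𝒞.levelIdeal_ne_top hk U hU hUo)

/-- The index type of good ideals. [folklore] -/
abbrev GoodIdeal : Type u := {𝔞 : Ideal (levelAmbient hk U hU) // 𝒞.IsGood hk U hU 𝔞}

/-- The comparison maps `R_U → Λ_U/𝔞` for good `𝔞`. [folklore] -/
def toGood (𝔞 : 𝒞.GoodIdeal hk U hU) :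
    𝒞.levelRing hk U hU hUo →ₐ[𝒪] (levelAmbient hk U hU).quotient 𝔞.1 𝔞.2.1 :=
  Ideal.Quotient.factorₐ 𝒪 (𝒞.levelIdeal_le hk U hU 𝔞.2)

/-- `toGood` on residue classes. [folklore] -/
theorem toGood_mk (𝔞 : 𝒞.GoodIdeal hk U hU) (x : levelAmbient hk U hU) :
    𝒞.toGood hk U hU hUo 𝔞 (Ideal.Quotient.mk _ x) = Ideal.Quotient.mk 𝔞.1 x := rfl

/-- The maps `R_U → Λ_U/𝔞`, `𝔞` good, are jointly injective (`I_U = ⋂ 𝔞`). [folklore] -/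
theorem toGood_jointly_injective (a : 𝒞.levelRing hk U hU hUo)
    (h : ∀ 𝔞 : 𝒞.GoodIdeal hk U hU, (𝒞.toGood hk U hU hUo 𝔞 :
      𝒞.levelRing hk U hU hUo →+* (levelAmbient hk U hU).quotient 𝔞.1 𝔞.2.1) a = 0) : a = 0 := by
  obtain ⟨x, rfl⟩ := Ideal.Quotient.mk_surjective a
  change Ideal.Quotient.mk (𝒞.levelIdeal hk U hU) x = 0
  rw [Ideal.Quotient.eq_zero_iff_mem, levelIdeal, Submodule.mem_sInf]
  intro 𝔞 h𝔞
  have := h ⟨𝔞, h𝔞⟩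
  exact Ideal.Quotient.eq_zero_iff_mem.1 this

/-- The admissible lift over `Λ_U/𝔞` witnessing that `𝔞` is good. [folklore] -/
def goodRep (𝔞 : 𝒞.GoodIdeal hk U hU) : Γ →* GL (Fin n) ((levelAmbient hk U hU) ⧸ 𝔞.1) :=
  𝔞.2.2.choose

/-- `goodRep 𝔞` is admissible. [folklore] -/
theorem goodRep_mem (𝔞 : 𝒞.GoodIdeal hk U hU) :
    𝒞.goodRep hk U hU 𝔞 ∈ 𝒞.carrier ((levelAmbient hk U hU).quotient 𝔞.1 𝔞.2.1) :=
  𝔞.2.2.choose_spec.1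

/-- `goodRep 𝔞` has the tautological entries. [folklore] -/
theorem goodRep_val (𝔞 : 𝒞.GoodIdeal hk U hU) (γ : Γ) :
    (𝒞.goodRep hk U hU 𝔞 γ).val = tautMatrix hk U hU 𝔞.1 γ :=
  𝔞.2.2.choose_spec.2.2 γ

/-- `goodRep 𝔞` is the image of the tautological matrices over `R_U`. [folklore] -/
theorem goodRep_val_eq_map (𝔞 : 𝒞.GoodIdeal hk U hU) (γ : Γ) :
    (𝒞.goodRep hk U hU 𝔞 γ).val =
      (tautMatrix hk U hU (𝒞.levelIdeal hk U hU) γ).map (𝒞.toGood hk U hU hUo 𝔞 :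
        𝒞.levelRing hk U hU hUo →+* (levelAmbient hk U hU).quotient 𝔞.1 𝔞.2.1) := by
  rw [goodRep_val]
  ext i j
  rfl

/-- **The tautological lift** `ρ_U : Γ → GL_n(R_U)`, `γ ↦ (X_{[γ],i,j} mod I_U)`.
[cite: Mazur1997Deformation, §20 Prop. 2] -/
def levelRep : Γ →* GL (Fin n) (𝒞.levelRing hk U hU hUo) :=
  glOfJointlyInjective (tautMatrix hk U hU (𝒞.levelIdeal hk U hU))
    (fun 𝔞 : 𝒞.GoodIdeal hk U hU => (𝒞.toGood hk U hU hUo 𝔞 :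
      𝒞.levelRing hk U hU hUo →+* (levelAmbient hk U hU).quotient 𝔞.1 𝔞.2.1))
    (𝒞.toGood_jointly_injective hk U hU hUo) (𝒞.goodRep hk U hU) (𝒞.goodRep_val_eq_map hk U hU hUo)

/-- The matrices of `ρ_U` are the tautological ones. [folklore] -/
@[simp] theorem levelRep_val (γ : Γ) :
    (𝒞.levelRep hk U hU hUo γ).val = tautMatrix hk U hU (𝒞.levelIdeal hk U hU) γ := rfl

/-- The entries of `ρ_U` are the variables `X_{[γ],i,j} mod I_U`. [folklore] -/
theorem levelRep_val_apply (γ : Γ) (i j : Fin n) :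
    (𝒞.levelRep hk U hU hUo γ).val i j =
      Ideal.Quotient.mk _ (PowerSeriesAt.X 𝒪 (levelPoint U hU) ⟨(γ : Γ ⧸ U), i, j⟩) := rfl

/-- `ρ_U` is trivial on `U`. [folklore] -/
theorem le_ker_levelRep : U ≤ (𝒞.levelRep hk U hU hUo).ker :=
  le_ker_of_val_eq_tautMatrix hk U hU fun _ => rfl

/-- `ρ_U` is admissible. [cite: Mazur1997Deformation, §20 Prop. 2] -/
theorem levelRep_mem : 𝒞.levelRep hk U hU hUo ∈ 𝒞.carrier (𝒞.levelRing hk U hU hUo) := by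
  refine 𝒞.mem_of_jointly_injective (ι := 𝒞.GoodIdeal hk U hU)
    (fun 𝔞 => (levelAmbient hk U hU).quotient 𝔞.1 𝔞.2.1) (𝒞.toGood hk U hU hUo)
    (𝒞.toGood_jointly_injective hk U hU hUo)
    (isAdicContinuous_of_le_ker U hUo (𝒞.le_ker_levelRep hk U hU hUo)) fun 𝔞 => ?_
  have := map_comp_glOfJointlyInjective (tautMatrix hk U hU (𝒞.levelIdeal hk U hU))
    (fun 𝔞 : 𝒞.GoodIdeal hk U hU => (𝒞.toGood hk U hU hUo 𝔞 :
      𝒞.levelRing hk U hU hUo →+* (levelAmbient hk U hU).quotient 𝔞.1 𝔞.2.1))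
    (𝒞.toGood_jointly_injective hk U hU hUo) (𝒞.goodRep hk U hU) (𝒞.goodRep_val_eq_map hk U hU hUo) 𝔞
  show (Matrix.GeneralLinearGroup.map (𝒞.toGood hk U hU hUo 𝔞 :
    𝒞.levelRing hk U hU hUo →+* (levelAmbient hk U hU).quotient 𝔞.1 𝔞.2.1)).comp
      (𝒞.levelRep hk U hU hUo) ∈ _
  have h' : (Matrix.GeneralLinearGroup.map (𝒞.toGood hk U hU hUo 𝔞 :
      𝒞.levelRing hk U hU hUo →+* (levelAmbient hk U hU).quotient 𝔞.1 𝔞.2.1)).comp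
      (𝒞.levelRep hk U hU hUo) = 𝒞.goodRep hk U hU 𝔞 := this
  rw [h']
  exact 𝒞.goodRep_mem hk U hU 𝔞

/-! #### The universal property of `(R_U, ρ_U)` -/

section Universal

variable {A : CNLAlgebra 𝒪 k} {ρ : Γ →* GL (Fin n) A} (hρ : ρ ∈ 𝒞.carrier A) (hρU : U ≤ ρ.ker)

/-- The `A`-point `(ρ(g)_{ij})` of the level variables. [folklore] -/
def levelPointOf : LevelVars (n := n) U → A :=
  fun v => (QuotientGroup.lift U ρ hρU v.1).val v.2.1 v.2.2

omit [TopologicalSpace Γ] [IsNoetherianRing 𝒪] [Finite (Γ ⧸ U)] in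
/-- `levelPointOf` on representatives. [folklore] -/
@[simp] theorem levelPointOf_mk (γ : Γ) (i j : Fin n) :
    levelPointOf U hρU ⟨(γ : Γ ⧸ U), i, j⟩ = (ρ γ).val i j := rfl

include hρ in
omit [IsNoetherianRing 𝒪] [Finite (Γ ⧸ U)] in
/-- The `A`-point `(ρ(g)_{ij})` reduces to the `k`-point `(r̄(g)_{ij})`. [folklore] -/
theorem residue_levelPointOf (v : LevelVars (n := n) U) :
    A.residue (levelPointOf U hρU v) = levelPoint U hU v := by
  obtain ⟨q, i, j⟩ := v
  induction q using QuotientGroup.induction_on with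
  | H γ => exact 𝒞.residue_apply_val hρ γ i j

/-- The evaluation `Λ_U → A`, `X_{[γ],i,j} ↦ ρ(γ)_{ij}`. [cite: Mazur1997Deformation, §20 Prop. 2] -/
def levelLiftAmbient : levelAmbient hk U hU →ₐ[𝒪] A :=
  PowerSeriesAt.lift A (levelPointOf U hρU) (𝒞.residue_levelPointOf U hU hρ hρU)

/-- `levelLiftAmbient` sends `X_{[γ],i,j}` to `ρ(γ)_{ij}`. [folklore] -/
theorem levelLiftAmbient_X (γ : Γ) (i j : Fin n) :
    𝒞.levelLiftAmbient hk U hU hρ hρU (PowerSeriesAt.X 𝒪 (levelPoint U hU) ⟨(γ : Γ ⧸ U), i, j⟩) =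
      (ρ γ).val i j :=
  PowerSeriesAt.lift_X A _ _ _

include hUo in
/-- **The kernels `ker(Λ_U → A/𝔪_A^{m+1})` are good**, hence contain `I_U`.
[cite: Mazur1997Deformation, §20 Prop. 2 (proof)] -/
theorem levelIdeal_le_ker_trunc (m : ℕ) :
    𝒞.levelIdeal hk U hU ≤ RingHom.ker
      ((A.toTrunc m).comp (𝒞.levelLiftAmbient hk U hU hρ hρU)).toRingHom := by
  refine 𝒞.levelIdeal_le hk U hU ?_
  have hne : RingHom.ker ((A.toTrunc m).comp (𝒞.levelLiftAmbient hk U hU hρ hρU)).toRingHom ≠ ⊤ :=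
    RingHom.ker_ne_top _
  -- the injection `Λ/𝔞 ↪ A/𝔪^{m+1}`
  let ι𝔞 : (levelAmbient hk U hU).quotient _ hne →ₐ[𝒪] A.trunc m :=
    Ideal.Quotient.liftₐ _ ((A.toTrunc m).comp (𝒞.levelLiftAmbient hk U hU hρ hρU)) fun a ha => ha
  have hι : ∀ x : levelAmbient hk U hU, ι𝔞 (Ideal.Quotient.mk _ x) =
      A.toTrunc m (𝒞.levelLiftAmbient hk U hU hρ hρU x) := fun x => rfl
  have hinj : Function.Injective ι𝔞 := by
    rw [injective_iff_map_eq_zero]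
    intro b hb
    obtain ⟨x, rfl⟩ := Ideal.Quotient.mk_surjective b
    exact Ideal.Quotient.eq_zero_iff_mem.2 (by rwa [hι] at hb)
  have hji : ∀ b : (levelAmbient hk U hU).quotient _ hne,
      (∀ _i : PUnit.{u + 1}, ι𝔞 b = 0) → b = 0 :=
    fun b h => hinj (by rw [h PUnit.unit, map_zero])
  -- the reduction of `ρ` modulo `𝔪^{m+1}` has the tautological entries
  have hval : ∀ (_i : PUnit.{u + 1}) (γ : Γ),
      ((Matrix.GeneralLinearGroup.map (A.toTrunc m : A →+* A.trunc m)).comp ρ γ).val =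
      (tautMatrix hk U hU _ γ).map
        (ι𝔞 : (levelAmbient hk U hU).quotient _ hne →+* A.trunc m) := by
    intro _ γ
    ext i j
    rw [Matrix.map_apply]
    change ((Matrix.GeneralLinearGroup.map (A.toTrunc m : A →+* A.trunc m)).comp ρ γ).val i j =
      ι𝔞 (Ideal.Quotient.mk _ (PowerSeriesAt.X 𝒪 (levelPoint U hU) ⟨(γ : Γ ⧸ U), i, j⟩))
    rw [hι, levelLiftAmbient_X]
    rfl
  obtain ⟨ρ𝔞, hρ𝔞, hcomp⟩ : ∃ ρ𝔞 : Γ →* GL (Fin n) ((levelAmbient hk U hU).quotient _ hne),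
      (∀ γ, (ρ𝔞 γ).val = tautMatrix hk U hU _ γ) ∧
      ∀ i : PUnit.{u + 1}, (Matrix.GeneralLinearGroup.map
        (ι𝔞 : (levelAmbient hk U hU).quotient _ hne →+* A.trunc m)).comp ρ𝔞 =
        (Matrix.GeneralLinearGroup.map (A.toTrunc m : A →+* A.trunc m)).comp ρ :=
    ⟨glOfJointlyInjective _ _ hji _ hval, fun _ => rfl, map_comp_glOfJointlyInjective _ _ hji _ hval⟩
  have hU𝔞 : U ≤ ρ𝔞.ker := le_ker_of_val_eq_tautMatrix hk U hU hρ𝔞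
  refine ⟨hne, ρ𝔞, ?_, hU𝔞, hρ𝔞⟩
  refine 𝒞.mem_of_jointly_injective (ι := PUnit.{u + 1}) (fun _ => A.trunc m) (fun _ => ι𝔞) hji
    (isAdicContinuous_of_le_ker U hUo hU𝔞) fun i => ?_
  show (Matrix.GeneralLinearGroup.map
    (ι𝔞 : (levelAmbient hk U hU).quotient _ hne →+* A.trunc m)).comp ρ𝔞 ∈ _
  rw [hcomp i]
  exact 𝒞.map_mem (A.toTrunc m) hρ

include hUo in
/-- `I_U ⊆ ker(Λ_U → A)`. [cite: Mazur1997Deformation, §20 Prop. 2 (proof)] -/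
theorem levelIdeal_le_ker :
    𝒞.levelIdeal hk U hU ≤ RingHom.ker (𝒞.levelLiftAmbient hk U hU hρ hρU : levelAmbient hk U hU →+* A) := by
  intro x hx
  rw [RingHom.mem_ker]
  refine A.eq_of_forall_mk_eq fun m => ?_
  rw [map_zero]
  cases m with
  | zero =>
    apply Ideal.Quotient.eq.2
    rw [pow_zero, Ideal.one_eq_top]
    exact Submodule.mem_top
  | succ m =>
    have := 𝒞.levelIdeal_le_ker_trunc hk U hU hUo hρ hρU m hx
    rw [RingHom.mem_ker] at this
    exact this

/-- **Universal property of `(R_U, ρ_U)`, existence**: the morphism `R_U → A` classifying an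
admissible lift `ρ` trivial on `U`. [cite: Mazur1997Deformation, §20 Prop. 2] -/
def levelLift : 𝒞.levelRing hk U hU hUo →ₐ[𝒪] A :=
  Ideal.Quotient.liftₐ (𝒞.levelIdeal hk U hU) (𝒞.levelLiftAmbient hk U hU hρ hρU)
    fun _ hx => 𝒞.levelIdeal_le_ker hk U hU hUo hρ hρU hx

/-- `levelLift` on residue classes. [folklore] -/
theorem levelLift_mk (x : levelAmbient hk U hU) :
    𝒞.levelLift hk U hU hUo hρ hρU (Ideal.Quotient.mk _ x) = 𝒞.levelLiftAmbient hk U hU hρ hρU x :=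
  rfl

/-- `ρ = levelLift ∘ ρ_U`. [cite: Mazur1997Deformation, §20 Prop. 2] -/
theorem map_comp_levelRep :
    (Matrix.GeneralLinearGroup.map (𝒞.levelLift hk U hU hUo hρ hρU : _ →+* A)).comp
      (𝒞.levelRep hk U hU hUo) = ρ := by
  refine MonoidHom.ext fun γ => Units.ext ?_
  ext i j
  change 𝒞.levelLiftAmbient hk U hU hρ hρU (PowerSeriesAt.X 𝒪 (levelPoint U hU) ⟨(γ : Γ ⧸ U), i, j⟩) =
    (ρ γ).val i j
  exact 𝒞.levelLiftAmbient_X hk U hU hρ hρU γ i j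

/-- **Universal property of `(R_U, ρ_U)`, uniqueness**. [cite: Mazur1997Deformation, §20 Prop. 2] -/
theorem levelLift_unique (ψ : 𝒞.levelRing hk U hU hUo →ₐ[𝒪] A)
    (hψ : (Matrix.GeneralLinearGroup.map (ψ : _ →+* A)).comp (𝒞.levelRep hk U hU hUo) = ρ) :
    ψ = 𝒞.levelLift hk U hU hUo hρ hρU := by
  refine Ideal.Quotient.algHom_ext 𝒪 (PowerSeriesAt.algHom_ext hk A fun v => ?_)
  obtain ⟨q, i, j⟩ := v
  induction q using QuotientGroup.induction_on with
  | H γ =>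
    change ψ ((𝒞.levelRep hk U hU hUo γ).val i j) =
      𝒞.levelLift hk U hU hUo hρ hρU ((𝒞.levelRep hk U hU hUo γ).val i j)
    have h1 := DFunLike.congr_fun hψ γ
    have h2 := DFunLike.congr_fun (𝒞.map_comp_levelRep hk U hU hUo hρ hρU) γ
    rw [MonoidHom.comp_apply] at h1 h2
    have e1 := Matrix.GeneralLinearGroup.map_apply (ψ : _ →+* A) i j (𝒞.levelRep hk U hU hUo γ)
    have e2 := Matrix.GeneralLinearGroup.map_apply (𝒞.levelLift hk U hU hUo hρ hρU : _ →+* A) i j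
      (𝒞.levelRep hk U hU hUo γ)
    rw [h1] at e1
    rw [h2] at e2
    exact e1.symm.trans e2

include hρ hρU in
/-- **Universal property of `(R_U, ρ_U)`** (Mazur, §20 Prop. 2, at finite level `Γ/U`): admissible
lifts `ρ : Γ → GL_n(A)` trivial on `U` correspond bijectively to morphisms `R_U → A` of
`Ĉ_𝒪(k)`, via `φ ↦ φ ∘ ρ_U`. [cite: Mazur1997Deformation, §20 Prop. 2] -/
theorem existsUnique_levelLift :
    ∃! φ : 𝒞.levelRing hk U hU hUo →ₐ[𝒪] A,
      (Matrix.GeneralLinearGroup.map (φ : _ →+* A)).comp (𝒞.levelRep hk U hU hUo) = ρ :=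
  ⟨𝒞.levelLift hk U hU hUo hρ hρU, 𝒞.map_comp_levelRep hk U hU hUo hρ hρU,
    fun ψ hψ => 𝒞.levelLift_unique hk U hU hUo hρ hρU ψ hψ⟩

end Universal

end Level

end LiftingCondition

end Literature.NumberTheory.GaloisRepresentations.Deformation
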